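import Literature.NumberTheory.Rogawski1990.ArchEndoscopicCurveRegularCompact        -- ★ B-p12 `ArchSingularCurveNormPair` (the lifted curve; FILE A Cayley frame), ★ (V8) `ArchStableClassTorus`, ★ `isCompact_centralizer_archDiagTorus`
import Literature.NumberTheory.Rogawski1990.ArchEndoscopicCentralCurveGSide          -- ★ (3G) F0P3a-p05: `transferFactor_delta_out_mk`, `integral_comp_conj_out_mk`, `card_filter_mk_relabel_eq_of_injective`
import Literature.NumberTheory.Rogawski1990.ArchExplicitTransferFactorLocallyConstant -- ★ `continuousOn_archExplicitDelta_of_isArchGRegular` (Δ″_∞ continuous on the G-regular matching locus)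
import Literature.NumberTheory.Automorphic.ArchTorusOrbitalContinuity               -- ★ (V2)-glob FILE B: `continuousOn_integral_comp_conj_archDiagTorus`
import HarnessLib

/-!
# The `Δ`-side of the archimedean endoscopic transfer identity, `Σ_{[γ′]} Δ(γ_H, γ′)·∫_{G′_∞} a′(g γ′ g⁻¹) dν′`, is CONTINUOUS on the `G`-regular part of the compact Cartan of
# `H_∞ = (U(Φ₂) × U(Φ₁))(L⁺ ⊗ ℝ)` — Haar currency, diagonal frame `G′_∞ = U(diag α)(L⁺ ⊗ ℝ)` (Rogawski 1990 §4.3, §8.2; Shelstad 1979 §4; Langlands–Shelstad 1987 Lemma 4.1.A)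

Topic `NumberTheory/Rogawski1990`; namespace `Literature.NumberTheory.Rogawski1990`.  THEOREMS ONLY (no `def`, no instance, no notation, no axiom, no named fact, no `sorry`).
Cell `pub/hodgecm-mathlib`, line LH3 (closer stub `stub_N9` = archimedean endoscopic transfer at `Δ″_∞`, crux H413 = `stmt-HodgeConjecture-24833`), organ **(W1)** of the DIRECT ROAD
(Bouaziz 1994 Rem. 2 p. 594 «avec les arguments de Shelstad … si `φ ∈ 𝒟(G)`, on peut prendre `φ^H` dans `𝒟(H)`»; LH3-plan (g2) DEALER WORDS #1, 2026-09-02; author LH3-p04 (g2)):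
the would-be transfer `φ^H(γ_H) := Σ_{[γ′]} Δ″_∞(γ_H, γ′)·Φ(γ′, a′)` of a test function `a′` is continuous at the `G`-regular points of the ELLIPTIC Cartan of `H_∞` (compact centralisers),
in the TORUS∕HAAR currency of the cell's wall programme (census «G-WALL» (0)–(W1); H-side twin (CONT-H-ell) by LH3-p01 (g3)).  CONSUMER: organ (SM-G′)∕(SEC) ⇒ **(W1-cont)**
= the first clause of (M1) «`Transf_Δ″` lands in `I^st_c(H_∞)`» of LH3-plan (g2)'s `MEMO-N9-direct-road.v1` §1∕§3 (the relabelled torus points `t(z∘ρ)` ARE the smooth local sections of the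
matched classes).  No compactness of `G′_∞` is used: at a regular `z` every partner has the compact torus as centraliser, so `g ↦ a′(g·t(z∘ρ)·g⁻¹)` has compact support for `a′ ∈ C_c`
(★ `isCompact_setOf_exists_conj_archDiagTorus_mem`, any signatures) — `hanis` enters ONLY through the continuity of `Δ″_∞` (★ `archKappaAt_ne_zero`).
THE FRAME.  `H′ = diag α` (`α_i ≠ 0`, `c(α_i) = α_i`; general anisotropic hermitian forms are congruent to one, ★ `ArchCongruenceTransport`), `G′_∞ = U(diag α)(L⁺ ⊗ ℝ)` with its circle torus
`t(z) = archDiagTorus L 3 α z` (`z : W → Fin 3 → S¹`), and the CAYLEY-FRAME torus family `γ_H(z) = ((P·diag(z_{w,0}, z_{w,2})·P⁻¹)_w, (z_{w,1})_w)` of `H_∞` (`P = (1 1; 1 −1)`, ★ FILE A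
`ArchEndoscopicTorusCayleyFrame`) = B-p12's lifted curve ★ `ArchSingularCurveNormPair` with the curve parameter replaced by the point (their `γH ψ` at `(z₀, c)` is this file's
`γH (fun w i => z₀ w i * Circle.exp (![1, 0, −1] i * (c w * ψ)))` by `rfl`); as there the family is a bare term under an EQUALITY BINDER `hγH` (instantiate with `rfl`).
WHAT IS PROVED.  §1 the family: `map_evalC_fst∕snd_cayleyTorus`, (private) `continuous_cayleyTorus`, **`isArchNormPair_cayleyTorus`** (`ι_∞(γ_H(z)) ↔ t(z)`, every `z`),
`isArchNormPair_cayleyTorus_relabel` (`↔ t(z∘ρ)`), **`isArchGRegular_cayleyTorus_iff`** (`G`-regular ⇔ every `z_w` injective), `isCompact_centralizer_of_isArchNormPair_cayleyTorus`.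
§2 class bookkeeping AT A POINT for any ★ `ArchTransferFactor T` (supported on matching pairs, a class function) and right-invariant `ν′`:
**`finsum_transferFactor_delta_mul_integral_eq_sum_relabel`** `Σᶠ_{c′} T.Δ(γ_H(z), out c′)·∫ a′(g·out c′·g⁻¹) dν′ = Σ_ρ n_ρ(z)⁻¹·(T.Δ(γ_H(z), t(z∘ρ))·∫ a′(g·t(z∘ρ)·g⁻¹) dν′)`
(`ρ : W → S₃`; on the regular set `n_ρ` is the `z`-free `#{ρ′ ∣ ∀ w, ρ′_w(P_w) = ρ_w(P_w)}`, ★ `card_filter_mk_relabel_eq_of_injective`: `…_of_injective`).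
§3 **`continuousOn_finsum_transferFactor_delta_mul_integral_comp_conj`** — THE HEAD: for `T` continuous on the `G`-regular matching locus (hypothesis `hT`), `ν′` finite on compacts and
right-invariant, `a′` continuous with compact support, `z ↦ Σᶠ_{c′} T.Δ(γ_H(z), out c′)·∫ a′(g·out c′·g⁻¹) dν′` is `ContinuousOn {z ∣ ∀ w, Injective (z w)}`; §4 corollaries for print's
`Δ″_∞ = archExplicitTransferFactor L (diag α) μ hl hr` on the anisotropic frame (★ `continuousOn_archExplicitDelta_of_isArchGRegular`) and for `a′ ∈ C_c^∞(G′_∞)` (★ `ArchSmooth`).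
CURRENCY (census (0)): the leaf reads `Φ([γ′], a′) = classOrbitalIntegral m′ a′ c′` over a compatible Weil-form system, `= (t′(out c′))(Z)⁻¹ · ∫ a′(g·out c′·g⁻¹) dν′` at a compact
centraliser (★ `integral_quotientMeasure_eq_inv_smul`); the Haar-currency statement is the system-free content (continuity in the leaf's currency holds for torus-normalised systems).
HONEST LABEL: HC_CM is proved only modulo the 7 printed citations (2 remaining: hLiu418 = stmt-HodgeConjecture-24832, h413 = stmt-HodgeConjecture-24833) until rung 0 closes; (W1) is the
first, soft organ of the direct road and pays nothing by itself (the jump matching (W3)∕(W4) and Bouaziz surjectivity (W5) remain).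

## References
* [Rogawski1990] J. D. Rogawski, *Automorphic Representations of Unitary Groups in Three Variables*, Ann. of Math. Stud. 123 (1990), §4.3 (4.3.1) p. 43, §4.1 (4.1.1) p. 39, §3.8 pp. 30–32,
  §8.2 Prop. 8.2.1 pp. 117–118, §8.3 p. 122.
* [Shelstad1979] D. Shelstad, *Characters and inner forms of a quasi-split group over `ℝ`*, Compositio Math. 39 (1979), §4.
* [LanglandsShelstad1987] R. P. Langlands, D. Shelstad, *On the definition of transfer factors*, Math. Ann. 278 (1987), Lemma 4.1.A.
-/

set_option autoImplicit false

noncomputable section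

open NumberField NumberField.InfinitePlace Matrix Filter Topology Complex Equiv MeasureTheory
open scoped MatrixGroups

namespace Literature.NumberTheory.Rogawski1990

open Literature.NumberTheory.Automorphic
open Literature.NumberTheory.GaloisRepresentations

section CayleyTorus

variable (L : Type) [Field L] [NumberField L] [IsCMField L] (α : Fin 3 → L)
  (γH : ({w : InfinitePlace L // IsComplex w} → Fin 3 → Circle) →
    ↥(UnitaryGroup.arch (↥(maximalRealSubfield L)) L (IsCMField.complexConj L) 2
        (Matrix.of fun i j : Fin 2 => if i.val + j.val + 1 = 2 then (1 : L) else 0)) ×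
      ↥(UnitaryGroup.arch (↥(maximalRealSubfield L)) L (IsCMField.complexConj L) 1
        (Matrix.of fun i j : Fin 1 => if i.val + j.val + 1 = 1 then (1 : L) else 0)))
  (hγH : γH = fun z =>
    ((UnitaryGroup.archPiEquivCM 2 L (Matrix.of fun i j : Fin 2 => if i.val + j.val + 1 = 2 then (1 : L) else 0)).symm fun w =>
        ⟨Matrix.GeneralLinearGroup.mkOfDetNeZero !![(1 : ℂ), 1; 1, -1] UnitaryGroup.det_cayleyTwo_ne_zero *
            UnitaryGroup.circleDiagonal 2 ![z w 0, z w 2] *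
          (Matrix.GeneralLinearGroup.mkOfDetNeZero !![(1 : ℂ), 1; 1, -1] UnitaryGroup.det_cayleyTwo_ne_zero)⁻¹,
          UnitaryGroup.cayley_conj_circleDiagonal_mem_archLocal L w _⟩,
      (UnitaryGroup.archPiEquivCM 1 L (Matrix.of fun i j : Fin 1 => if i.val + j.val + 1 = 1 then (1 : L) else 0)).symm fun w =>
        ⟨UnitaryGroup.circleDiagonal 1 ![z w 1], UnitaryGroup.circleDiagonal_mem_archLocal_antidiagOne L w _⟩))

/-! ## §1 The Cayley-frame torus family `γ_H(z)` of `H_∞`: components, continuity, matching with `t(z)`, `G`-regularity -/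

include hγH in
/-- The `w`-component of the `U(Φ₂)`-block of `γ_H(z)`: `P · diag(z_{w,0}, z_{w,2}) · P⁻¹`. [cite: Rogawski1990, §8.2 p. 122] -/
theorem map_evalC_fst_cayleyTorus (z : {w : InfinitePlace L // IsComplex w} → Fin 3 → Circle) (w : {w : InfinitePlace L // IsComplex w}) :
    Matrix.GeneralLinearGroup.map (UnitaryGroup.evalC L w) (((γH z).1 : ↥(UnitaryGroup.arch (↥(maximalRealSubfield L)) L (IsCMField.complexConj L) 2
        (Matrix.of fun i j : Fin 2 => if i.val + j.val + 1 = 2 then (1 : L) else 0))) : GL (Fin 2) (mixedEmbedding.mixedSpace L)) =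
      Matrix.GeneralLinearGroup.mkOfDetNeZero !![(1 : ℂ), 1; 1, -1] UnitaryGroup.det_cayleyTwo_ne_zero *
          UnitaryGroup.circleDiagonal 2 ![z w 0, z w 2] *
        (Matrix.GeneralLinearGroup.mkOfDetNeZero !![(1 : ℂ), 1; 1, -1] UnitaryGroup.det_cayleyTwo_ne_zero)⁻¹ := by
  subst hγH
  change (((UnitaryGroup.archPiEquivCM 2 L (Matrix.of fun i j : Fin 2 => if i.val + j.val + 1 = 2 then (1 : L) else 0))
    ((UnitaryGroup.archPiEquivCM 2 L (Matrix.of fun i j : Fin 2 => if i.val + j.val + 1 = 2 then (1 : L) else 0)).symm _) w :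
      ↥(UnitaryGroup.archLocal L 2 (Matrix.of fun i j : Fin 2 => if i.val + j.val + 1 = 2 then (1 : L) else 0) w)) : GL (Fin 2) ℂ) = _
  rw [ContinuousMulEquiv.apply_symm_apply]

include hγH in
/-- The `w`-component of the `U(Φ₁)`-entry of `γ_H(z)`: `diag(z_{w,1})`. [cite: Rogawski1990, §8.2 p. 122] -/
theorem map_evalC_snd_cayleyTorus (z : {w : InfinitePlace L // IsComplex w} → Fin 3 → Circle) (w : {w : InfinitePlace L // IsComplex w}) :
    Matrix.GeneralLinearGroup.map (UnitaryGroup.evalC L w) (((γH z).2 : ↥(UnitaryGroup.arch (↥(maximalRealSubfield L)) L (IsCMField.complexConj L) 1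
        (Matrix.of fun i j : Fin 1 => if i.val + j.val + 1 = 1 then (1 : L) else 0))) : GL (Fin 1) (mixedEmbedding.mixedSpace L)) =
      UnitaryGroup.circleDiagonal 1 ![z w 1] := by
  subst hγH
  change (((UnitaryGroup.archPiEquivCM 1 L (Matrix.of fun i j : Fin 1 => if i.val + j.val + 1 = 1 then (1 : L) else 0))
    ((UnitaryGroup.archPiEquivCM 1 L (Matrix.of fun i j : Fin 1 => if i.val + j.val + 1 = 1 then (1 : L) else 0)).symm _) w :
      ↥(UnitaryGroup.archLocal L 1 (Matrix.of fun i j : Fin 1 => if i.val + j.val + 1 = 1 then (1 : L) else 0) w)) : GL (Fin 1) ℂ) = _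
  rw [ContinuousMulEquiv.apply_symm_apply]

include hγH in
/-- **The Cayley-frame family is continuous in the torus coordinates** (★ `archPiEquivCM` is a homeomorphism; `circleDiagonal` and the evaluations `z ↦ z w i` are continuous).
(Private: same shape as ★ B-p12 `continuous_archSingularCurveH`, of which it is the all-coordinates twin.) [cite: Rogawski1990, §8.2 p. 122] -/
private theorem continuous_cayleyTorus : Continuous γH := by
  subst hγH
  refine Continuous.prodMk ?_ ?_
  · refine (UnitaryGroup.archPiEquivCM 2 L _).symm.continuous.comp (continuous_pi fun w => Continuous.subtype_mk ?_ _)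
    have hv : Continuous fun a : ({w : InfinitePlace L // IsComplex w} → Fin 3 → Circle) => ![a w 0, a w 2] := by fun_prop
    exact (continuous_const.mul ((UnitaryGroup.continuous_circleDiagonal 2).comp hv)).mul continuous_const
  · refine (UnitaryGroup.archPiEquivCM 1 L _).symm.continuous.comp (continuous_pi fun w => Continuous.subtype_mk ?_ _)
    have hv : Continuous fun a : ({w : InfinitePlace L // IsComplex w} → Fin 3 → Circle) => ![a w 1] := by fun_prop
    exact (UnitaryGroup.continuous_circleDiagonal 1).comp hv

include hγH in
/-- **`ι_∞(γ_H(z)) ↔ t(z)` FOR EVERY `z`**: at each complex place `ι(P·diag(a,b)·P⁻¹, u) = ι(P,1)·diag(a,u,b)·ι(P,1)⁻¹` (★ FILE A `isConj_endoGL_cayley_conj_circleDiagonal`), and conjugacy in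
`GL₃(L ⊗ ℝ)` is place-wise (★ `isConj_of_forall_isConj_map_evalC`). [cite: Rogawski1990, §8.2 p. 122; §4.9 p. 54; §14.3 p. 234] -/
theorem isArchNormPair_cayleyTorus (z : {w : InfinitePlace L // IsComplex w} → Fin 3 → Circle) :
    IsArchNormPair L (Matrix.diagonal α) (γH z) (UnitaryGroup.archDiagTorus L 3 α z) := by
  rw [isArchNormPair_iff]
  unfold Corresponds
  refine UnitaryGroup.isConj_of_forall_isConj_map_evalC L fun w => ?_
  rw [coe_endoEmbArch, map_endoGL, map_evalC_fst_cayleyTorus L γH hγH z w, map_evalC_snd_cayleyTorus L γH hγH z w]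
  have hG : Matrix.GeneralLinearGroup.map (UnitaryGroup.evalC L w)
      ((UnitaryGroup.archDiagTorus L 3 α z : ↥(UnitaryGroup.arch (↥(maximalRealSubfield L)) L (IsCMField.complexConj L) 3 (Matrix.diagonal α))) :
        GL (Fin 3) (mixedEmbedding.mixedSpace L)) = UnitaryGroup.circleDiagonal 3 (z w) :=
    UnitaryGroup.archAt_archDiagTorus L 3 α z w
  rw [hG]
  convert UnitaryGroup.isConj_endoGL_cayley_conj_circleDiagonal (z w 0) (z w 2) (z w 1) using 2
  funext i; fin_cases i <;> rfl

include hγH in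
/-- **`ι_∞(γ_H(z)) ↔ t(z ∘ ρ)` for every relabelling `ρ : W → S₃`**: the relabelled torus point is stably conjugate to `t(z)` (★ (V8) `isStablyConj_archDiagTorus_iff_exists_of_conj`) and
`↔` only sees stable classes (★ `Corresponds.of_isStablyConj_right`). [cite: Rogawski1990, §3.8 pp. 30–32; §14.1 p. 232] -/
theorem isArchNormPair_cayleyTorus_relabel
    (z : {w : InfinitePlace L // IsComplex w} → Fin 3 → Circle) (ρ : {w : InfinitePlace L // IsComplex w} → Perm (Fin 3)) :
    IsArchNormPair L (Matrix.diagonal α) (γH z) (UnitaryGroup.archDiagTorus L 3 α fun w => z w ∘ ρ w) := by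
  have h := isArchNormPair_cayleyTorus L α γH hγH z
  rw [isArchNormPair_iff] at h ⊢
  exact Corresponds.of_isStablyConj_right h
    ((UnitaryGroup.isStablyConj_archDiagTorus_iff_exists_of_conj L 3 α z _).mpr ⟨ρ, rfl⟩)

include hγH in
/-- **`γ_H(z)` is `G`-REGULAR iff the three circle coordinates are pairwise distinct at every place**: regularity passes along `ι_∞(γ_H(z)) ↔ t(z)` (★ `isRegularElt_of_isConj`) and
`t(z)` is regular iff every `z_w` is injective (★ `isRegularElt_archDiagTorus_iff`). [cite: Rogawski1990, §3.1 p. 19; §4.3 p. 42] -/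
theorem isArchGRegular_cayleyTorus_iff (z : {w : InfinitePlace L // IsComplex w} → Fin 3 → Circle) :
    IsArchGRegular L (γH z) ↔ ∀ w : {w : InfinitePlace L // IsComplex w}, Function.Injective (z w) := by
  have hnp := isArchNormPair_cayleyTorus L (fun _ : Fin 3 => (1 : L)) γH hγH z
  rw [isArchNormPair_iff] at hnp
  rw [← UnitaryGroup.isRegularElt_archDiagTorus_iff L 3 (fun _ : Fin 3 => (1 : L)) z]
  exact ⟨fun h => isRegularElt_of_isConj hnp h, fun h => isRegularElt_of_isConj hnp.symm h⟩

include hγH in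
/-- **Every norm partner of a `G`-regular `γ_H(z)` has a COMPACT centraliser** (`α_i ≠ 0` fixed by `c`): the partner is stably conjugate to `t(z)`, hence conjugate to a relabelled
torus point (★ (V8) `exists_isConj_archDiagTorus_of_isStablyConj_of_conj`), whose centraliser is the compact torus (★ `isCompact_centralizer_archDiagTorus`) — so the partners' Haar
orbital integrals `∫_{G′_∞} a′(g γ′ g⁻¹) dν′` are the honest currency. [cite: Rogawski1990, §3.1 p. 19; §14.3 p. 234] -/
theorem isCompact_centralizer_of_isArchNormPair_cayleyTorus (hα : ∀ i, α i ≠ 0) (hherm : ∀ i, (IsCMField.complexConj L (α i) : L) = α i)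
    (z : {w : InfinitePlace L // IsComplex w} → Fin 3 → Circle) (hz : ∀ w, Function.Injective (z w))
    (γ' : ↥(UnitaryGroup.arch (↥(maximalRealSubfield L)) L (IsCMField.complexConj L) 3 (Matrix.diagonal α))) (hnp : IsArchNormPair L (Matrix.diagonal α) (γH z) γ') :
    IsCompact ((Subgroup.centralizer ({γ'} : Set ↥(UnitaryGroup.arch (↥(maximalRealSubfield L)) L (IsCMField.complexConj L) 3 (Matrix.diagonal α)))) :
      Set ↥(UnitaryGroup.arch (↥(maximalRealSubfield L)) L (IsCMField.complexConj L) 3 (Matrix.diagonal α))) := by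
  have hnpG := isArchNormPair_cayleyTorus L α γH hγH z
  rw [isArchNormPair_iff] at hnp hnpG
  have hst : IsStablyConj (UnitaryGroup.conjMixed (↥(maximalRealSubfield L)) L (IsCMField.complexConj L)) (UnitaryGroup.archFormOf L 3 (Matrix.diagonal α))
      (UnitaryGroup.archDiagTorus L 3 α z) γ' := hnpG.symm.trans hnp
  obtain ⟨ρ, hρ⟩ := UnitaryGroup.exists_isConj_archDiagTorus_of_isStablyConj_of_conj L 3 α hα hherm _ γ' hst
  exact isCompact_centralizer_singleton_of_isConj hρ (UnitaryGroup.isCompact_centralizer_archDiagTorus L 3 α hα fun w => (hz w).comp (ρ w).injective)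

/-! ## §2 Class bookkeeping at a torus point: the `Σᶠ` over classes as a weighted sum over relabellings -/

variable (T : ArchTransferFactor L (Matrix.diagonal α))
  [MeasurableSpace ↥(UnitaryGroup.arch (↥(maximalRealSubfield L)) L (IsCMField.complexConj L) 3 (Matrix.diagonal α))]
  [BorelSpace ↥(UnitaryGroup.arch (↥(maximalRealSubfield L)) L (IsCMField.complexConj L) 3 (Matrix.diagonal α))]
  (ν' : Measure ↥(UnitaryGroup.arch (↥(maximalRealSubfield L)) L (IsCMField.complexConj L) 3 (Matrix.diagonal α))) [ν'.IsMulRightInvariant]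
  (a' : ↥(UnitaryGroup.arch (↥(maximalRealSubfield L)) L (IsCMField.complexConj L) 3 (Matrix.diagonal α)) → ℂ)

include hγH in
omit [MeasurableSpace ↥(UnitaryGroup.arch (↥(maximalRealSubfield L)) L (IsCMField.complexConj L) 3 (Matrix.diagonal α))]
  [BorelSpace ↥(UnitaryGroup.arch (↥(maximalRealSubfield L)) L (IsCMField.complexConj L) 3 (Matrix.diagonal α))] in
open scoped Classical in
/-- **THE SUPPORT of `c′ ↦ T.Δ(γ_H(z), out c′) · (anything)` LIES IN `{⟦t(z∘ρ)⟧}_ρ`**: `T.Δ ≠ 0` forces matching (`T.eq_zero_of_not_rel`), the matching classes form the stable class of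
`t(z)` (★ `Corresponds.isStablyConj_right`), which ★ (V8) `conjClasses_stable_archDiagTorus_eq_range_of_conj` lists. [cite: Rogawski1990, §4.1 (4.1.1) p. 39; §4.3 p. 43] -/
theorem support_transferFactor_delta_mul_subset_image_relabel (hα : ∀ i, α i ≠ 0) (hherm : ∀ i, (IsCMField.complexConj L (α i) : L) = α i)
    (F : ConjClasses ↥(UnitaryGroup.arch (↥(maximalRealSubfield L)) L (IsCMField.complexConj L) 3 (Matrix.diagonal α)) → ℂ)
    (z : {w : InfinitePlace L // IsComplex w} → Fin 3 → Circle) :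
    (Function.support fun c' : ConjClasses ↥(UnitaryGroup.arch (↥(maximalRealSubfield L)) L (IsCMField.complexConj L) 3 (Matrix.diagonal α)) => T.Δ (γH z) (Quotient.out c') * F c') ⊆
      ↑(Finset.univ.image fun ρ : {w : InfinitePlace L // IsComplex w} → Perm (Fin 3) => ConjClasses.mk (UnitaryGroup.archDiagTorus L 3 α fun w => z w ∘ ρ w)) := by
  intro c' hc'
  rw [Function.mem_support] at hc'
  have hΔ : T.Δ (γH z) (Quotient.out c') ≠ 0 := fun h => hc' (by rw [h, zero_mul])
  have hrel : IsArchNormPair L (Matrix.diagonal α) (γH z) (Quotient.out c') := by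
    by_contra h; exact hΔ (T.eq_zero_of_not_rel _ _ h)
  have h0 := isArchNormPair_cayleyTorus L α γH hγH z
  rw [isArchNormPair_iff] at h0 hrel
  have hst := Corresponds.isStablyConj_right h0 hrel
  have hmem : c' ∈ {q : ConjClasses ↥(UnitaryGroup.arch (↥(maximalRealSubfield L)) L (IsCMField.complexConj L) 3 (Matrix.diagonal α)) |
      IsStablyConj (UnitaryGroup.conjMixed (↥(maximalRealSubfield L)) L (IsCMField.complexConj L)) (UnitaryGroup.archFormOf L 3 (Matrix.diagonal α))
        (UnitaryGroup.archDiagTorus L 3 α z) (Quotient.out q)} := hst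
  rw [UnitaryGroup.conjClasses_stable_archDiagTorus_eq_range_of_conj L 3 α hα hherm] at hmem
  obtain ⟨ρ, hρ⟩ := hmem
  rw [Finset.coe_image, Finset.coe_univ, Set.image_univ]
  exact ⟨ρ, hρ⟩

include hγH in
open scoped Classical in
/-- **THE `Δ`-SIDE AT `γ_H(z)` AS A WEIGHTED SUM OVER RELABELLINGS**: with `n_ρ(z) = #{ρ′ ∣ ⟦t(z∘ρ′)⟧ = ⟦t(z∘ρ)⟧}`,
`Σᶠ_{c′} T.Δ(γ_H(z), out c′)·∫ a′(g·out c′·g⁻¹) dν′ = Σ_ρ n_ρ(z)⁻¹ · (T.Δ(γ_H(z), t(z∘ρ)) · ∫ a′(g·t(z∘ρ)·g⁻¹) dν′)` — every `z` (`T.Δ(γ_H, ·)` and the Haar orbital integral are class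
functions: `T.conj_right`, right-invariance of `ν′`). [cite: Rogawski1990, §4.1 (4.1.1) p. 39; §4.3 p. 43] -/
theorem finsum_transferFactor_delta_mul_integral_eq_sum_relabel (hα : ∀ i, α i ≠ 0) (hherm : ∀ i, (IsCMField.complexConj L (α i) : L) = α i)
    (z : {w : InfinitePlace L // IsComplex w} → Fin 3 → Circle) :
    ∑ᶠ c' : ConjClasses ↥(UnitaryGroup.arch (↥(maximalRealSubfield L)) L (IsCMField.complexConj L) 3 (Matrix.diagonal α)),
        T.Δ (γH z) (Quotient.out c') * ∫ g, a' (g * Quotient.out c' * g⁻¹) ∂ν' =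
      ∑ ρ : {w : InfinitePlace L // IsComplex w} → Perm (Fin 3),
        ((Finset.univ.filter fun ρ' : {w : InfinitePlace L // IsComplex w} → Perm (Fin 3) =>
            ConjClasses.mk (UnitaryGroup.archDiagTorus L 3 α fun w => z w ∘ ρ' w) = ConjClasses.mk (UnitaryGroup.archDiagTorus L 3 α fun w => z w ∘ ρ w)).card : ℂ)⁻¹ *
          (T.Δ (γH z) (UnitaryGroup.archDiagTorus L 3 α fun w => z w ∘ ρ w) * ∫ g, a' (g * (UnitaryGroup.archDiagTorus L 3 α fun w => z w ∘ ρ w) * g⁻¹) ∂ν') := by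
  rw [finsum_eq_finsetSum_of_support_subset _ (support_transferFactor_delta_mul_subset_image_relabel L α γH hγH T hα hherm
    (fun c' => ∫ g, a' (g * Quotient.out c' * g⁻¹) ∂ν') z)]
  symm
  refine (Finset.sum_image' _ fun ρ _ => ?_).symm
  -- on the fibre of `ρ` every summand equals `n_ρ⁻¹ · (value at ρ)`
  rw [transferFactor_delta_out_mk, integral_comp_conj_out_mk]
  have hconst : ∀ ρ' ∈ Finset.univ.filter (fun ρ' : {w : InfinitePlace L // IsComplex w} → Perm (Fin 3) =>
      ConjClasses.mk (UnitaryGroup.archDiagTorus L 3 α fun w => z w ∘ ρ' w) = ConjClasses.mk (UnitaryGroup.archDiagTorus L 3 α fun w => z w ∘ ρ w)),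
      ((Finset.univ.filter fun ρ'' : {w : InfinitePlace L // IsComplex w} → Perm (Fin 3) =>
          ConjClasses.mk (UnitaryGroup.archDiagTorus L 3 α fun w => z w ∘ ρ'' w) = ConjClasses.mk (UnitaryGroup.archDiagTorus L 3 α fun w => z w ∘ ρ' w)).card : ℂ)⁻¹ *
          (T.Δ (γH z) (UnitaryGroup.archDiagTorus L 3 α fun w => z w ∘ ρ' w) * ∫ g, a' (g * (UnitaryGroup.archDiagTorus L 3 α fun w => z w ∘ ρ' w) * g⁻¹) ∂ν') =
        ((Finset.univ.filter fun ρ' : {w : InfinitePlace L // IsComplex w} → Perm (Fin 3) =>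
            ConjClasses.mk (UnitaryGroup.archDiagTorus L 3 α fun w => z w ∘ ρ' w) = ConjClasses.mk (UnitaryGroup.archDiagTorus L 3 α fun w => z w ∘ ρ w)).card : ℂ)⁻¹ *
          (T.Δ (γH z) (UnitaryGroup.archDiagTorus L 3 α fun w => z w ∘ ρ w) * ∫ g, a' (g * (UnitaryGroup.archDiagTorus L 3 α fun w => z w ∘ ρ w) * g⁻¹) ∂ν') := by
    intro ρ' hρ'
    rw [Finset.mem_filter] at hρ'
    have he := hρ'.2
    have hfib : (Finset.univ.filter fun ρ'' : {w : InfinitePlace L // IsComplex w} → Perm (Fin 3) =>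
          ConjClasses.mk (UnitaryGroup.archDiagTorus L 3 α fun w => z w ∘ ρ'' w) = ConjClasses.mk (UnitaryGroup.archDiagTorus L 3 α fun w => z w ∘ ρ' w)) =
        Finset.univ.filter fun ρ'' : {w : InfinitePlace L // IsComplex w} → Perm (Fin 3) =>
          ConjClasses.mk (UnitaryGroup.archDiagTorus L 3 α fun w => z w ∘ ρ'' w) = ConjClasses.mk (UnitaryGroup.archDiagTorus L 3 α fun w => z w ∘ ρ w) := by
      ext ρ''; simp only [Finset.mem_filter, Finset.mem_univ, true_and, he]
    rw [hfib, ← transferFactor_delta_out_mk L (Matrix.diagonal α) T (γH z) (UnitaryGroup.archDiagTorus L 3 α fun w => z w ∘ ρ' w),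
      ← integral_comp_conj_out_mk ν' a' (UnitaryGroup.archDiagTorus L 3 α fun w => z w ∘ ρ' w), he, transferFactor_delta_out_mk, integral_comp_conj_out_mk]
  rw [Finset.sum_congr rfl hconst, Finset.sum_const, nsmul_eq_mul, ← mul_assoc, mul_inv_cancel₀, one_mul]
  exact Nat.cast_ne_zero.mpr (Finset.card_ne_zero.mpr ⟨ρ, Finset.mem_filter.mpr ⟨Finset.mem_univ _, rfl⟩⟩)

include hγH in
open scoped Classical in
/-- **On the REGULAR set the multiplicities are `z`-free**: for `z` with every `z_w` injective the weighted sum of the previous theorem has the constant weights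
`N_ρ = #{ρ′ ∣ ∀ w, ρ′_w(P_w) = ρ_w(P_w)}` (`P_w = {i ∣ re σ_w(α_i) > 0}`; ★ `card_filter_mk_relabel_eq_of_injective`). [cite: Rogawski1990, §3.8 pp. 30–32; §4.1 (4.1.1) p. 39] -/
theorem finsum_transferFactor_delta_mul_integral_eq_sum_relabel_of_injective (hα : ∀ i, α i ≠ 0) (hherm : ∀ i, (IsCMField.complexConj L (α i) : L) = α i)
    (z : {w : InfinitePlace L // IsComplex w} → Fin 3 → Circle) (hz : ∀ w, Function.Injective (z w)) :
    ∑ᶠ c' : ConjClasses ↥(UnitaryGroup.arch (↥(maximalRealSubfield L)) L (IsCMField.complexConj L) 3 (Matrix.diagonal α)),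
        T.Δ (γH z) (Quotient.out c') * ∫ g, a' (g * Quotient.out c' * g⁻¹) ∂ν' =
      ∑ ρ : {w : InfinitePlace L // IsComplex w} → Perm (Fin 3),
        ((Finset.univ.filter fun ρ' : {w : InfinitePlace L // IsComplex w} → Perm (Fin 3) => ∀ w : {w : InfinitePlace L // IsComplex w},
            (Finset.univ.filter fun i : Fin 3 => 0 < (w.1.embedding (α i)).re).image (ρ' w) =
              (Finset.univ.filter fun i : Fin 3 => 0 < (w.1.embedding (α i)).re).image (ρ w)).card : ℂ)⁻¹ *
          (T.Δ (γH z) (UnitaryGroup.archDiagTorus L 3 α fun w => z w ∘ ρ w) * ∫ g, a' (g * (UnitaryGroup.archDiagTorus L 3 α fun w => z w ∘ ρ w) * g⁻¹) ∂ν') := by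
  rw [finsum_transferFactor_delta_mul_integral_eq_sum_relabel L α γH hγH T ν' a' hα hherm z]
  refine Finset.sum_congr rfl fun ρ _ => ?_
  rw [card_filter_mk_relabel_eq_of_injective L α hα (fun w i => UnitaryGroup.im_embedding_eq_zero_of_complexConj_eq L w (hherm i)) z hz ρ]

/-! ## §3 Continuity on the `G`-regular set -/

include hγH in
omit [MeasurableSpace ↥(UnitaryGroup.arch (↥(maximalRealSubfield L)) L (IsCMField.complexConj L) 3 (Matrix.diagonal α))]
  [BorelSpace ↥(UnitaryGroup.arch (↥(maximalRealSubfield L)) L (IsCMField.complexConj L) 3 (Matrix.diagonal α))] in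
/-- **`z ↦ T.Δ(γ_H(z), t(z∘ρ))` is continuous on the regular set** for a transfer factor continuous on the `G`-regular matching locus (`hT`): the pair `(γ_H(z), t(z∘ρ))` moves
continuously (★ `continuous_cayleyTorus`, ★ `continuous_archDiagTorus`) inside that locus (`isArchNormPair_cayleyTorus_relabel`, `isArchGRegular_cayleyTorus_iff`).
[cite: LanglandsShelstad1987, Lemma 4.1.A] [cite: Rogawski1990, §4.3 p. 43] -/
theorem continuousOn_transferFactor_delta_cayleyTorus_relabel
    (hT : ContinuousOn
      (fun q : (↥(UnitaryGroup.arch (↥(maximalRealSubfield L)) L (IsCMField.complexConj L) 2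
          (Matrix.of fun i j : Fin 2 => if i.val + j.val + 1 = 2 then (1 : L) else 0)) ×
        ↥(UnitaryGroup.arch (↥(maximalRealSubfield L)) L (IsCMField.complexConj L) 1
          (Matrix.of fun i j : Fin 1 => if i.val + j.val + 1 = 1 then (1 : L) else 0))) ×
        ↥(UnitaryGroup.arch (↥(maximalRealSubfield L)) L (IsCMField.complexConj L) 3 (Matrix.diagonal α)) => T.Δ q.1 q.2)
      {q | IsArchNormPair L (Matrix.diagonal α) q.1 q.2 ∧ IsArchGRegular L q.1})
    (ρ : {w : InfinitePlace L // IsComplex w} → Perm (Fin 3)) :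
    ContinuousOn (fun z : {w : InfinitePlace L // IsComplex w} → Fin 3 → Circle => T.Δ (γH z) (UnitaryGroup.archDiagTorus L 3 α fun w => z w ∘ ρ w))
      {z | ∀ w, Function.Injective (z w)} := by
  have hc : Continuous fun z : {w : InfinitePlace L // IsComplex w} → Fin 3 → Circle =>
      (γH z, UnitaryGroup.archDiagTorus L 3 α fun w => z w ∘ ρ w) := by
    refine (continuous_cayleyTorus L γH hγH).prodMk ((UnitaryGroup.continuous_archDiagTorus L 3 α).comp ?_)
    exact continuous_pi fun w => continuous_pi fun i => (continuous_apply (ρ w i)).comp (continuous_apply w)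
  refine hT.comp hc.continuousOn fun z hz => ?_
  exact ⟨isArchNormPair_cayleyTorus_relabel L α γH hγH z ρ, (isArchGRegular_cayleyTorus_iff L γH hγH z).mpr hz⟩

omit [ν'.IsMulRightInvariant] in
/-- **`z ↦ ∫ a′(g·t(z∘ρ)·g⁻¹) dν′` is continuous on the regular set** (`a′` continuous with compact support, `ν′` finite on compacts): ★ `continuousOn_integral_comp_conj_archDiagTorus` at the
relabelled point, which is again regular. [cite: Rogawski1990, §8.3 p. 122] [cite: Shelstad1979, §4] -/
theorem continuousOn_integral_comp_conj_archDiagTorus_relabel (hα : ∀ i, α i ≠ 0) [IsFiniteMeasureOnCompacts ν'] (ha' : Continuous a') (ha'c : HasCompactSupport a')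
    (ρ : {w : InfinitePlace L // IsComplex w} → Perm (Fin 3)) :
    ContinuousOn (fun z : {w : InfinitePlace L // IsComplex w} → Fin 3 → Circle => ∫ g, a' (g * (UnitaryGroup.archDiagTorus L 3 α fun w => z w ∘ ρ w) * g⁻¹) ∂ν')
      {z | ∀ w, Function.Injective (z w)} := by
  have hc : Continuous fun z : {w : InfinitePlace L // IsComplex w} → Fin 3 → Circle => fun w => z w ∘ ρ w :=
    continuous_pi fun w => continuous_pi fun i => (continuous_apply (ρ w i)).comp (continuous_apply w)
  refine (UnitaryGroup.continuousOn_integral_comp_conj_archDiagTorus L 3 α hα ν' a' ha' ha'c).comp hc.continuousOn fun z hz => ?_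
  exact fun w => (hz w).comp (ρ w).injective

include hγH in
open scoped Classical in
/-- **THE `Δ`-SIDE IS CONTINUOUS ON THE `G`-REGULAR PART OF THE COMPACT CARTAN OF `H_∞`** (Haar currency, diagonal frame): for a transfer factor `T` continuous on the `G`-regular
matching locus, a right-invariant measure `ν′` finite on compacts and a continuous compactly supported `a′` on `G′_∞ = U(diag α)(L⁺ ⊗ ℝ)`,
`z ↦ Σᶠ_{c′} T.Δ(γ_H(z), out c′)·∫_{G′_∞} a′(g·out c′·g⁻¹) dν′(g)` is continuous on `{z ∣ ∀ w, z_w injective}` — on that open set it is the FIXED finite combination of §2, each term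
continuous by the two previous theorems. [cite: Shelstad1979, §4] [cite: Rogawski1990, §4.3 (4.3.1) p. 43; §8.2 Prop. 8.2.1 p. 118] [cite: LanglandsShelstad1987, Lemma 4.1.A] -/
theorem continuousOn_finsum_transferFactor_delta_mul_integral_comp_conj (hα : ∀ i, α i ≠ 0) (hherm : ∀ i, (IsCMField.complexConj L (α i) : L) = α i)
    (hT : ContinuousOn
      (fun q : (↥(UnitaryGroup.arch (↥(maximalRealSubfield L)) L (IsCMField.complexConj L) 2
          (Matrix.of fun i j : Fin 2 => if i.val + j.val + 1 = 2 then (1 : L) else 0)) ×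
        ↥(UnitaryGroup.arch (↥(maximalRealSubfield L)) L (IsCMField.complexConj L) 1
          (Matrix.of fun i j : Fin 1 => if i.val + j.val + 1 = 1 then (1 : L) else 0))) ×
        ↥(UnitaryGroup.arch (↥(maximalRealSubfield L)) L (IsCMField.complexConj L) 3 (Matrix.diagonal α)) => T.Δ q.1 q.2)
      {q | IsArchNormPair L (Matrix.diagonal α) q.1 q.2 ∧ IsArchGRegular L q.1})
    [IsFiniteMeasureOnCompacts ν'] (ha' : Continuous a') (ha'c : HasCompactSupport a') :
    ContinuousOn (fun z : {w : InfinitePlace L // IsComplex w} → Fin 3 → Circle =>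
        ∑ᶠ c' : ConjClasses ↥(UnitaryGroup.arch (↥(maximalRealSubfield L)) L (IsCMField.complexConj L) 3 (Matrix.diagonal α)),
          T.Δ (γH z) (Quotient.out c') * ∫ g, a' (g * Quotient.out c' * g⁻¹) ∂ν')
      {z | ∀ w, Function.Injective (z w)} := by
  have hmodel : ContinuousOn (fun z : {w : InfinitePlace L // IsComplex w} → Fin 3 → Circle =>
      ∑ ρ : {w : InfinitePlace L // IsComplex w} → Perm (Fin 3),
        ((Finset.univ.filter fun ρ' : {w : InfinitePlace L // IsComplex w} → Perm (Fin 3) => ∀ w : {w : InfinitePlace L // IsComplex w},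
            (Finset.univ.filter fun i : Fin 3 => 0 < (w.1.embedding (α i)).re).image (ρ' w) =
              (Finset.univ.filter fun i : Fin 3 => 0 < (w.1.embedding (α i)).re).image (ρ w)).card : ℂ)⁻¹ *
          (T.Δ (γH z) (UnitaryGroup.archDiagTorus L 3 α fun w => z w ∘ ρ w) * ∫ g, a' (g * (UnitaryGroup.archDiagTorus L 3 α fun w => z w ∘ ρ w) * g⁻¹) ∂ν'))
      {z | ∀ w, Function.Injective (z w)} := by
    refine continuousOn_finsetSum _ fun ρ _ => continuousOn_const.mul ?_
    exact (continuousOn_transferFactor_delta_cayleyTorus_relabel L α γH hγH T hT ρ).mul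
      (continuousOn_integral_comp_conj_archDiagTorus_relabel L α ν' a' hα ha' ha'c ρ)
  refine hmodel.congr fun z hz => ?_
  exact finsum_transferFactor_delta_mul_integral_eq_sum_relabel_of_injective L α γH hγH T ν' a' hα hherm z hz

end CayleyTorus

/-! ## §4 Print's factor `Δ″_∞` and test functions `a′ ∈ C_c^∞(G′_∞)` -/

section Explicit

variable (L : Type) [Field L] [NumberField L] [IsCMField L] (α : Fin 3 → L)

/-- The diagonal frame is `c`-hermitian in matrix form: `(diag α)ᶜᵀ = diag α` for `c(α_i) = α_i`. [cite: Rogawski1990, §4.9 p. 54] -/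
theorem conjTranspose_map_diagonal_eq_of_complexConj_eq (hherm : ∀ i, (IsCMField.complexConj L (α i) : L) = α i) :
    ((Matrix.diagonal α).map (cmConjRingHom L)).transpose = Matrix.diagonal α := by
  rw [Matrix.diagonal_map (map_zero _), Matrix.diagonal_transpose]
  congr 1
  funext i
  exact hherm i

variable
  (γH : ({w : InfinitePlace L // IsComplex w} → Fin 3 → Circle) →
    ↥(UnitaryGroup.arch (↥(maximalRealSubfield L)) L (IsCMField.complexConj L) 2
        (Matrix.of fun i j : Fin 2 => if i.val + j.val + 1 = 2 then (1 : L) else 0)) ×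
      ↥(UnitaryGroup.arch (↥(maximalRealSubfield L)) L (IsCMField.complexConj L) 1
        (Matrix.of fun i j : Fin 1 => if i.val + j.val + 1 = 1 then (1 : L) else 0)))
  (hγH : γH = fun z =>
    ((UnitaryGroup.archPiEquivCM 2 L (Matrix.of fun i j : Fin 2 => if i.val + j.val + 1 = 2 then (1 : L) else 0)).symm fun w =>
        ⟨Matrix.GeneralLinearGroup.mkOfDetNeZero !![(1 : ℂ), 1; 1, -1] UnitaryGroup.det_cayleyTwo_ne_zero *
            UnitaryGroup.circleDiagonal 2 ![z w 0, z w 2] *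
          (Matrix.GeneralLinearGroup.mkOfDetNeZero !![(1 : ℂ), 1; 1, -1] UnitaryGroup.det_cayleyTwo_ne_zero)⁻¹,
          UnitaryGroup.cayley_conj_circleDiagonal_mem_archLocal L w _⟩,
      (UnitaryGroup.archPiEquivCM 1 L (Matrix.of fun i j : Fin 1 => if i.val + j.val + 1 = 1 then (1 : L) else 0)).symm fun w =>
        ⟨UnitaryGroup.circleDiagonal 1 ![z w 1], UnitaryGroup.circleDiagonal_mem_archLocal_antidiagOne L w _⟩))
  (μ : HeckeCharacter L)
  (hl : ∀ (a : ↥(UnitaryGroup.arch (↥(maximalRealSubfield L)) L (IsCMField.complexConj L) 2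
            (Matrix.of fun i j : Fin 2 => if i.val + j.val + 1 = 2 then (1 : L) else 0)) ×
          ↥(UnitaryGroup.arch (↥(maximalRealSubfield L)) L (IsCMField.complexConj L) 1
            (Matrix.of fun i j : Fin 1 => if i.val + j.val + 1 = 1 then (1 : L) else 0)))
        (b : ↥(UnitaryGroup.arch (↥(maximalRealSubfield L)) L (IsCMField.complexConj L) 3 (Matrix.diagonal α)))
        (x : ↥(UnitaryGroup.arch (↥(maximalRealSubfield L)) L (IsCMField.complexConj L) 2
            (Matrix.of fun i j : Fin 2 => if i.val + j.val + 1 = 2 then (1 : L) else 0)) ×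
          ↥(UnitaryGroup.arch (↥(maximalRealSubfield L)) L (IsCMField.complexConj L) 1
            (Matrix.of fun i j : Fin 1 => if i.val + j.val + 1 = 1 then (1 : L) else 0))),
        archExplicitDelta L (Matrix.diagonal α) (x * a * x⁻¹) μ b = archExplicitDelta L (Matrix.diagonal α) a μ b)
  (hr : ∀ (a : ↥(UnitaryGroup.arch (↥(maximalRealSubfield L)) L (IsCMField.complexConj L) 2
            (Matrix.of fun i j : Fin 2 => if i.val + j.val + 1 = 2 then (1 : L) else 0)) ×
          ↥(UnitaryGroup.arch (↥(maximalRealSubfield L)) L (IsCMField.complexConj L) 1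
            (Matrix.of fun i j : Fin 1 => if i.val + j.val + 1 = 1 then (1 : L) else 0)))
        (b y : ↥(UnitaryGroup.arch (↥(maximalRealSubfield L)) L (IsCMField.complexConj L) 3 (Matrix.diagonal α))),
        archExplicitDelta L (Matrix.diagonal α) a μ (y * b * y⁻¹) = archExplicitDelta L (Matrix.diagonal α) a μ b)
  [MeasurableSpace ↥(UnitaryGroup.arch (↥(maximalRealSubfield L)) L (IsCMField.complexConj L) 3 (Matrix.diagonal α))]
  [BorelSpace ↥(UnitaryGroup.arch (↥(maximalRealSubfield L)) L (IsCMField.complexConj L) 3 (Matrix.diagonal α))]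
  (ν' : Measure ↥(UnitaryGroup.arch (↥(maximalRealSubfield L)) L (IsCMField.complexConj L) 3 (Matrix.diagonal α))) [ν'.IsMulRightInvariant] [IsFiniteMeasureOnCompacts ν']

include hγH in
open scoped Classical in
/-- **(W1) FOR PRINT'S `Δ″_∞`**: on the ANISOTROPIC diagonal frame (`hanis` — the inner form of the route is definite at some place), for a right-invariant `ν′` finite on compacts and a
continuous compactly supported `a′`, `z ↦ Σᶠ_{c′} Δ″_∞(γ_H(z), out c′)·∫_{G′_∞} a′(g·out c′·g⁻¹) dν′` is continuous on the `G`-regular set (★ `continuousOn_archExplicitDelta_of_isArchGRegular`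
feeds `hT`). [cite: Rogawski1990, §4.9 p. 55; §14.6 p. 242; §8.2 Prop. 8.2.1 p. 118] [cite: LanglandsShelstad1987, Lemma 4.1.A] [cite: Shelstad1979, §4] -/
theorem continuousOn_finsum_archExplicitDelta_mul_integral_comp_conj (hα : ∀ i, α i ≠ 0) (hherm : ∀ i, (IsCMField.complexConj L (α i) : L) = α i)
    (hanis : ∀ x : Fin 3 → L, Literature.AlgebraicGeometry.ShimuraVarieties.hermForm (cmConjRingHom L) (Matrix.diagonal α) x x = 0 → x = 0)
    (a' : ↥(UnitaryGroup.arch (↥(maximalRealSubfield L)) L (IsCMField.complexConj L) 3 (Matrix.diagonal α)) → ℂ) (ha' : Continuous a') (ha'c : HasCompactSupport a') :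
    ContinuousOn (fun z : {w : InfinitePlace L // IsComplex w} → Fin 3 → Circle =>
        ∑ᶠ c' : ConjClasses ↥(UnitaryGroup.arch (↥(maximalRealSubfield L)) L (IsCMField.complexConj L) 3 (Matrix.diagonal α)),
          (archExplicitTransferFactor L (Matrix.diagonal α) μ hl hr).Δ (γH z) (Quotient.out c') * ∫ g, a' (g * Quotient.out c' * g⁻¹) ∂ν')
      {z | ∀ w, Function.Injective (z w)} :=
  continuousOn_finsum_transferFactor_delta_mul_integral_comp_conj L α γH hγH (archExplicitTransferFactor L (Matrix.diagonal α) μ hl hr) ν' a' hα hherm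
    (continuousOn_archExplicitDelta_of_isArchGRegular L (Matrix.diagonal α) (conjTranspose_map_diagonal_eq_of_complexConj_eq L α hherm) hanis μ) ha' ha'c

include hγH in
open scoped Classical in
/-- **(W1) FOR `Δ″_∞` AND A TEST FUNCTION `a′ ∈ C_c^∞(G′_∞)`** (★ `ArchSmooth`: continuous — ★ `ArchSmooth.continuous` — with compact support — ★ `ArchSmooth.hasCompactSupport`), the
vocabulary of `stub_N9`'s organ texts. [cite: Rogawski1990, §14.3 p. 234; §4.9 p. 55] [cite: Shelstad1979, §4] -/
theorem continuousOn_finsum_archExplicitDelta_mul_integral_comp_conj_of_archSmooth (hα : ∀ i, α i ≠ 0) (hherm : ∀ i, (IsCMField.complexConj L (α i) : L) = α i)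
    (hanis : ∀ x : Fin 3 → L, Literature.AlgebraicGeometry.ShimuraVarieties.hermForm (cmConjRingHom L) (Matrix.diagonal α) x x = 0 → x = 0)
    (a' : ↥(UnitaryGroup.arch (↥(maximalRealSubfield L)) L (IsCMField.complexConj L) 3 (Matrix.diagonal α)) → ℂ) (ha' : ArchSmooth L 3 (Matrix.diagonal α) a') :
    ContinuousOn (fun z : {w : InfinitePlace L // IsComplex w} → Fin 3 → Circle =>
        ∑ᶠ c' : ConjClasses ↥(UnitaryGroup.arch (↥(maximalRealSubfield L)) L (IsCMField.complexConj L) 3 (Matrix.diagonal α)),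
          (archExplicitTransferFactor L (Matrix.diagonal α) μ hl hr).Δ (γH z) (Quotient.out c') * ∫ g, a' (g * Quotient.out c' * g⁻¹) ∂ν')
      {z | ∀ w, Function.Injective (z w)} :=
  continuousOn_finsum_archExplicitDelta_mul_integral_comp_conj L α γH hγH μ hl hr ν' hα hherm hanis a' ha'.continuous ha'.hasCompactSupport

end Explicit

end Literature.NumberTheory.Rogawski1990

end
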